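import Mathlib.Analysis.Convex.Integral
import Mathlib.MeasureTheory.Integral.Average
import Literature.MathematicalPhysics.QuantumFieldTheory.BalabanBlockSpecification
import HarnessLib

/-!
# Route `SourcedPressureJensen`, crux `SourcedPressureDecoupling` (KS2″, stmt-QuantumFields-24296 / rev-7 stmt-24028):
# RESTRICTED JENSEN — a partition function is bounded below by a good event

Mechanism (3) of the rev-8 item ("the SEAM ENTROPY is counted WITHOUT a uniform smooth gauge: … restricted Jensen
`−log E_{ν₀} e^{−W} ≤ −log ν₀(E) + E_{ν₀}[W | E]` on the event `E` = {adjacent cells small-field, crossing links in the Haar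
ball}") is the elementary inequality: for a probability measure `μ`, a measurable event `E` of positive probability and a real
`W` with `e^{−W}` integrable and `W` integrable on `E`,

  `log μ(E) − ⨍_E W dμ ≤ log ∫ e^{−W} dμ`,  i.e.  `−log E e^{−W} ≤ −log μ(E) + E[W | E]`

(`∫ e^{−W} ≥ ∫_E e^{−W} = μ(E)·⨍_E e^{−W} ≥ μ(E)·e^{−⨍_E W}`, Jensen on `E`).  This file proves it abstractly
(`log_measureReal_sub_setAverage_le_log_integral_exp_neg`) and for the torus Wilson state with a CONTINUOUS `W` in ratio form
(`wilson_restricted_jensen`: `log P(E) − E[W·𝟙_E]/P(E) ≤ log E[e^{−W}]`).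

Everything is proved; no definition, no named fact.  RECORD-label rung support (route target `XiPow` = an upper bound on the
lattice gap); the Yang–Mills mass gap is NOT proved by anything here. [folklore]
-/

set_option autoImplicit false

noncomputable section

open MeasureTheory Real Set
open Literature.MathematicalPhysics.QuantumFieldTheory Literature.MathematicalPhysics.QuantumLattice

namespace Summit.QuantumFields.YangMills.Theorems.SourcedPressureJensen

/-! ### Abstract probability space -/

section Abstract

variable {α : Type*} [MeasurableSpace α] {μ : Measure α} [IsProbabilityMeasure μ]

/-- **Restricted Jensen.**  For a probability measure `μ`, an event `E` with `μ E ≠ 0`, and a real `W` with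
`e^{−W}` integrable and `W` integrable on `E`:  `log μ(E) − ⨍_{E} W dμ ≤ log ∫ e^{−W} dμ`
(equivalently `−log ∫e^{−W} ≤ −log μ(E) + E[W | E]`). [folklore] -/
theorem log_measureReal_sub_setAverage_le_log_integral_exp_neg {E : Set α}
    (hE0 : μ E ≠ 0) (W : α → ℝ) (hW : IntegrableOn W E μ)
    (heW : Integrable (fun x => Real.exp (-W x)) μ) :
    Real.log (μ.real E) - ⨍ x in E, W x ∂μ ≤ Real.log (∫ x, Real.exp (-W x) ∂μ) := by
  have hEtop : μ E ≠ ⊤ := measure_ne_top μ E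
  have hEpos : 0 < μ.real E := by
    rw [measureReal_def]; exact ENNReal.toReal_pos hE0 hEtop
  -- Jensen on `E` for `exp ∘ (−W)`
  have hWn : IntegrableOn (fun x => -W x) E μ := hW.neg
  have heWE : IntegrableOn (fun x => Real.exp (-W x)) E μ := heW.integrableOn
  have hJ := ConvexOn.map_set_average_le (μ := μ) (t := E) (f := fun x => -W x) (g := Real.exp) convexOn_exp
    Real.continuous_exp.continuousOn isClosed_univ hE0 hEtop (ae_of_all _ fun _ => Set.mem_univ _) hWn heWE
  -- `⨍_E e^{−W} = (μ E)⁻¹ ∫_E e^{−W} ≤ (μ E)⁻¹ ∫ e^{−W}`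
  have havg : ⨍ x in E, Real.exp (-W x) ∂μ = (μ.real E)⁻¹ * ∫ x in E, Real.exp (-W x) ∂μ := by
    rw [setAverage_eq, smul_eq_mul]
  have hmono : ∫ x in E, Real.exp (-W x) ∂μ ≤ ∫ x, Real.exp (-W x) ∂μ :=
    setIntegral_le_integral heW (ae_of_all _ fun x => (Real.exp_pos _).le)
  have havgW : ⨍ x in E, -W x ∂μ = -⨍ x in E, W x ∂μ := by
    rw [setAverage_eq, setAverage_eq, integral_neg, smul_eq_mul, smul_eq_mul, mul_neg]
  have h1 : Real.exp (-⨍ x in E, W x ∂μ) ≤ (μ.real E)⁻¹ * ∫ x, Real.exp (-W x) ∂μ := by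
    calc Real.exp (-⨍ x in E, W x ∂μ) = Real.exp (⨍ x in E, -W x ∂μ) := by rw [havgW]
      _ ≤ ⨍ x in E, Real.exp (-W x) ∂μ := hJ
      _ = (μ.real E)⁻¹ * ∫ x in E, Real.exp (-W x) ∂μ := havg
      _ ≤ (μ.real E)⁻¹ * ∫ x, Real.exp (-W x) ∂μ := mul_le_mul_of_nonneg_left hmono (inv_nonneg.2 hEpos.le)
  have hZ : 0 < ∫ x, Real.exp (-W x) ∂μ := integral_exp_pos heW
  have h2 := Real.log_le_log (Real.exp_pos _) h1
  rw [Real.log_exp, Real.log_mul (inv_ne_zero hEpos.ne') hZ.ne', Real.log_inv] at h2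
  linarith

/-- The same in "`−log Z ≤ −log μ(E) + E[W·𝟙_E]/μ(E)`" form. [folklore] -/
theorem neg_log_integral_exp_neg_le {E : Set α} (hE0 : μ E ≠ 0) (W : α → ℝ)
    (hW : IntegrableOn W E μ) (heW : Integrable (fun x => Real.exp (-W x)) μ) :
    -Real.log (∫ x, Real.exp (-W x) ∂μ) ≤ -Real.log (μ.real E) + (∫ x in E, W x ∂μ) / μ.real E := by
  have h := log_measureReal_sub_setAverage_le_log_integral_exp_neg (μ := μ) hE0 W hW heW
  rw [setAverage_eq, smul_eq_mul] at h
  rw [div_eq_inv_mul]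
  linarith

end Abstract

/-! ### The torus Wilson state -/

section Wilson

variable {G : Type} [Group G] [TopologicalSpace G] [IsTopologicalGroup G] [CompactSpace G]
  [MeasurableSpace G] [BorelSpace G]

/-- **Restricted Jensen for the torus Wilson state** (ratio form): for a continuous `W`, a measurable event `E` of positive
probability and `E = wilsonExpectation r.ρ β`, `P = wilsonMeasure r.ρ β`:
`log P(E) − E[W·𝟙_E]/P(E) ≤ log E[e^{−W}]` — a sourced/seam partition function is bounded below by any good event and the
mean of the exponent on it. [folklore] -/
theorem wilson_restricted_jensen (r : LatticeRep G) (β : ℝ) {L : ℕ} [NeZero L] {W : GaugeConfig 4 L G → ℝ}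
    (hW : Continuous W) {E : Set (GaugeConfig 4 L G)} (hE : MeasurableSet E)
    (hE0 : wilsonMeasure (d := 4) (L := L) r.ρ β E ≠ 0) :
    Real.log ((wilsonMeasure (d := 4) (L := L) r.ρ β).real E) -
        wilsonExpectation r.ρ β (fun U => E.indicator W U) / (wilsonMeasure (d := 4) (L := L) r.ρ β).real E ≤
      Real.log (wilsonExpectation r.ρ β fun U => Real.exp (-W U)) := by
  haveI := isProbabilityMeasure_wilsonMeasure (d := 4) (L := L) (G := G) r.ρ r.continuous β
  haveI := r.secondCountableTopology
  have hWi : Integrable W (wilsonMeasure (d := 4) (L := L) r.ρ β) :=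
    hW.integrable_of_hasCompactSupport (HasCompactSupport.of_compactSpace _)
  have heW : Integrable (fun U => Real.exp (-W U)) (wilsonMeasure (d := 4) (L := L) r.ρ β) :=
    (Real.continuous_exp.comp hW.neg).integrable_of_hasCompactSupport (HasCompactSupport.of_compactSpace _)
  have h := log_measureReal_sub_setAverage_le_log_integral_exp_neg (μ := wilsonMeasure (d := 4) (L := L) r.ρ β)
    hE0 W hWi.integrableOn heW
  rw [setAverage_eq, smul_eq_mul, ← integral_indicator hE] at h
  unfold wilsonExpectation
  rw [div_eq_inv_mul]
  exact h

end Wilson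

end Summit.QuantumFields.YangMills.Theorems.SourcedPressureJensen

end
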